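import Summits.ABC.IUTFork.DAGC312l
import Summits.ABC.IUTFork.Cor312EdgeYamashita
import Summits.ABC.IUTFork.Cor312EdgeAggregate
import Summits.ABC.IUTFork.Cor312Least

/-!
# Kernel DAG index — layer C312, part m: what the loci hypothesis still hides after Δ4, and the weakest region-level licence

index v1 · abc-iut-c312-2 (filer, gen 2) per HOME/plan/KERNEL-DAG-SPEC.md v1.3 §2(e), §4. APPEND-ONLY (new theorems over the frozen
readings and apexes; nothing redefined). Two kernel-visible sharpenings of the apex ladder, no side taken:

1. `lociReadingG_of_eleven` — **the loci hypothesis, made transparent.** For a full situation `S` (c312-1 A–D) the composed reading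
   `lociReadingG S pending` (G ∘ F ∘ M ∘ V2 ∘ Δ3 ∘ Δ4, part l) of the 85 loci cited by the statement and proof of [IUTchIII] Cor. 3.12
   holds at EVERY locus as soon as (a) Theorem 3.11 as typed holds for `S` (`S.Statement`), (b) (IPL) as read holds (`S.link.IPL`), and
   (c) `pending` is granted at ELEVEN named loci (`unresolvedV4`: the four section-level citations [IUTchI] §2, §§4–6, [IUTchII] §2, §3;
   [AbsAnab] Prop 1.2.1 (vii); (SHE); and the `pending` conjuncts of [EtTh], Cor 2.3, Rmk 1.5.1, Rmk 2.3.3, [IUTchII] Rmk 1.11.3) —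
   because every other knitted locus is a clause of `S.Statement`, a DATA/predicate alias, an owner-NOTED row, or an index node whose
   `_holds`/`_part` witness IS a landed kernel theorem. So in the apex `summit_of_cor312_M_eleven` the former opaque hypothesis
   `hV2 : ∀ c, lociReadingV2 pending c` is replaced by `hIPL` and `hrest : ∀ c ∈ unresolvedV4, pending c`: kernel_hyps = 11
   (hInd, hadm, hreal, hqreal, hThm, hIPL, hrest, hC, hread, hΘ, hq), of which `hrest` now covers 11 of 85 loci instead of ~50;
   `xi_f_upstream_unresolved`: of the 75 loci Step (xi-f) rests on (`Cor312Least`), exactly 9 are among these 11.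
2. THE DISPUTED INFERENCE AT THREE LEVELS, weakest hypotheses first. (a) `summit_of_cor312_M_gap` — GLOBAL (volume level, the
   print's own quantifier: (xi-d)/(xi-f) compare the two procession-normalized NUMBERS): `hThm : Statement` (Theorem 3.11 as typed for
   the situation) and `hGap : Statement → Cor312At` (THAT it yields Cor. 3.12's aggregate inequality for the same situation) — kernel_hyps
   = 5 (hInd, hThm, hGap, hΘ, hq); `hGap` is exactly the inference the printed positions dispute, and c312-1's `Thm311ToCor312` /
   `Checks.independence` (p411317 + sequel) certify it is NOT derivable from the typed premises alone (a model with `Statement`, (IPL),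
   log-volume invariance and every catalogued side condition in which `Cor312At` fails). (a′) `summit_of_cor312_M_licence_agg` —
   AGGREGATE region level (V-e `Cor312EdgeAggregate`: `Statement → QCongruentSubHullAgg`, an admissible family of sub-regions of the
   hulls whose procession-normalized aggregate log-volume is `−|log(q)|`, no packet-by-packet equality; kernel_hyps = 8) — implied by
   every componentwise licence (`licence_agg_of_congruent`), implies the gap (it IS the proof of (a′)), and NOT refuted by the
   deep-bad-place argument below (V-e `aggCongruent_tolerates_componentwise_failure`). (b) `summit_of_cor312_M_licence_congruent` —
   COMPONENTWISE, region level, in its weakest form: the licence of `DAGC312g.summit_of_cor312_M_licence` (`Statement → QSubHull` in every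
   component, Reading 2) weakened to Yamashita's Reading 4 (`Cor312EdgeYamashita`, p411306; = skel's `QIsoInHull`, ForkRegions §7
   p410864, same `Prop`): in every component the hull CONTAINS AN ADMISSIBLE REGION OF LOG-VOLUME `−|log(q)|`; kernel_hyps = 8. By
   `four_readings` it is implied by each of the R1/R2/R3 licences (`licence_congruent_of_*`), and it implies the global gap
   (`gap_of_licence_congruent`). CAVEAT recorded, not adjudicated (skel INBOX FORK FINDING 2026-08-25T23:23Z; kernel form XXIV `ForkLocalGlobal` +
   XXIVb witness, which type the quantifier fork and assert nothing about the intended model): every COMPONENTWISE reading (R2/R3/R4 at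
   each `(j, v_ℚ)`) is argued there to fail in intended models with a deep bad place (the Θ-side packet volume
   at label `j ≥ 2` is `∝ −j²·ord_v(q_v)`, below the `q`-side `∝ −ord_v(q_v)`), so (b)'s disputed hypothesis may be unsatisfiable where it
   matters — the componentwise apexes record LOGICAL SUFFICIENCY of the readings, the global apex (a) is the faithful shape.
THIS FILE PROVES NOTHING NEW about [IUTchIII] AND ASSERTS NOTHING: every theorem is a case split over the 85 loci closed by landed
witnesses BY NAME, or a one-line re-composition of landed apexes. Nothing here says abc is proved or refuted or takes a side on
Cor. 3.12. typed ≠ discharged; indexed ≠ endorsed. [claim: Mochizuki2012, status: disputed]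
-/

noncomputable section

namespace Summit.ABC.IUTFork.DAG

open Cor312Proof Thm311

/-! ## 1. The eleven loci at which the composed reading still consults `pending` -/

/-- The loci of Cor. 3.12 NOT resolved to a landed node / situation field / alias after Δ4 (part l census: 6 bare + 5 partly knitted).
DATA (a list), not a claim. [folklore] -/
def unresolvedV4 : List Locus :=
  [.chI_sec2, .chI_sec4_5_6, .chII_sec2, .chII_sec3_cor3_5_3_6, .absAnab_prop1_2_1_vii, .SHE,
   .etTh, .cor2_3, .rem1_5_1, .rem2_3_3, .chII_rem1_11_3]

/-- `unresolvedV4` has 11 entries, no repeats. [folklore] -/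
theorem unresolvedV4_length : unresolvedV4.length = 11 ∧ unresolvedV4.Nodup := by decide

variable {T : ThetaIndex} (S : FullSituation T) (pending : Locus → Prop)

/-- **What (xi-f) still rests on, opaquely.** Of the 75 loci upstream of Step (xi-f) (`Cor312Least.upstream_xi_f`: the loci cited by
the fifteen nodes (xi-f) uses, transitively), exactly NINE are among the eleven unresolved ones — [IUTchIII] Cor 2.3 / Rmk 1.5.1 /
Rmk 2.3.3 (partly knitted), (SHE), [IUTchI] §§4–6, [IUTchII] Rmk 1.11.3 (partly), [IUTchII] §3, [AbsAnab] Prop 1.2.1 (vii), [EtTh]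
(partly); the other two unresolved loci ([IUTchI] §2, [IUTchII] §2) feed only Step (viii), which (xi-f) does not use. [folklore] -/
theorem xi_f_upstream_unresolved :
    (Step.xi_f.upstreamLoci.filter fun c => decide (c ∈ unresolvedV4)) =
      [.cor2_3, .rem1_5_1, .rem2_3_3, .SHE, .chI_sec4_5_6, .chII_rem1_11_3, .chII_sec3_cor3_5_3_6,
        .absAnab_prop1_2_1_vii, .etTh] := by
  decide

/-- **The composed loci reading holds everywhere, given Theorem 3.11 as typed, (IPL), and `pending` at the eleven unresolved loci.**
Proof: a case split over the 85 loci; each resolved locus is closed by a projection of `S.Statement`, by `trivial` (data / noted), or by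
the landed `_holds`/`_part` witness of its index node BY NAME. [folklore] -/
theorem lociReadingG_of_eleven (hS : S.Statement) (hIPL : S.link.IPL) (hrest : ∀ c ∈ unresolvedV4, pending c) :
    ∀ c, lociReadingG S pending c := by
  have hI : S.PartI := hS.1
  have hII : S.PartII := hS.2.1
  have h1 : pending .chI_sec2 := hrest _ (by decide)
  have h2 : pending .chI_sec4_5_6 := hrest _ (by decide)
  have h3 : pending .chII_sec2 := hrest _ (by decide)
  have h4 : pending .chII_sec3_cor3_5_3_6 := hrest _ (by decide)
  have h5 : pending .absAnab_prop1_2_1_vii := hrest _ (by decide)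
  have h6 : pending .SHE := hrest _ (by decide)
  have h7 : pending .etTh := hrest _ (by decide)
  have h8 : pending .cor2_3 := hrest _ (by decide)
  have h9 : pending .rem1_5_1 := hrest _ (by decide)
  have h10 : pending .rem2_3_3 := hrest _ (by decide)
  have h11 : pending .chII_rem1_11_3 := hrest _ (by decide)
  intro c
  cases c <;> first
    | exact trivial
    | exact hIPL
    | exact hS
    | exact h1 | exact h2 | exact h3 | exact h4 | exact h5 | exact h6
    -- Theorem 3.11 loci through the situation (F and M readings)
    | exact hS.2.2.1
    | exact hS.2.2.2.1
    | exact hS.2.2.2.2.1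
    | exact ⟨hS.2.2.2.2.2.1, hS.2.2.2.2.2.2⟩
    | exact hI.1
    | exact hI.2.1
    | exact hI.2.2
    | exact S.toLatticeSituation.ind3_of_partII hII
    | exact fun n => (hII n).1
    | exact fun n => (hII n).2.1
    | exact fun n => (hII n).2.2.1
    | exact fun n => (hII n).2.2.2.2.2
    -- V2 nodes (DAGC312e) and their partly-knitted conjunctions
    | exact N_IUTchIII_Prop3_9_i_part
    | exact N_IUTchIII_Def3_8_ii_holds
    | exact N_IUTchIII_Rmk3_6_2_i_holds
    | exact N_IUTchIII_Rmk3_9_5_i_holds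
    | exact N_IUTchIII_Rmk3_9_5_vii_holds
    | exact N_IUTchIII_Rmk3_9_5_ix_holds
    | exact ⟨N_IUTchIII_Rmk3_1_1_ii_holds, N_IUTchIII_Rmk3_1_1_iii_holds, N_IUTchIII_Rmk3_1_1_iv_holds⟩
    | exact ⟨N_IUTchIII_Cor2_3_ii_part, h8⟩
    | exact ⟨N_IUTchIII_Rmk1_5_1_ii_holds, h9⟩
    | exact ⟨N_IUTchIII_Rmk2_3_3_vi_holds, N_IUTchIII_Rmk2_3_3_vii_holds, h10⟩
    -- Δ3 nodes (DAGC312i)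
    | exact N_IUTchII_Cor4_10_i_part
    | exact ⟨⟨N_EtTh_Prop1_4_i_part, N_EtTh_Prop1_4_ii_part, N_EtTh_Def2_10_part, N_EtTh_Prop2_11_i_part,
        N_EtTh_Prop2_14_ii_part, N_EtTh_Def1_9_ii_holds, N_EtTh_Def2_13_i_holds⟩, h7⟩
    -- Δ4 nodes (DAGC312k / DAGC312rem / DAGL5c)
    | exact N_IUTchIII_Thm1_5_iii_part
    | exact N_IUTchIII_Thm1_5_iv_part
    | exact N_IUTchIII_Rmk1_2_2_iii_holds
    | exact N_IUTchIII_Rmk2_1_1_v_holds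
    | exact N_IUTchIII_Rmk2_2_2_iii_holds
    | exact N_IUTchIII_Rmk2_4_2_iv_holds
    | exact N_IUTchIII_Rmk3_9_3_holds
    | exact N_IUTchIII_Rmk3_9_6_holds
    | exact N_IUTchIII_Rmk3_9_7_i_holds
    | exact N_IUTchIII_Rmk3_11_1_ii_holds
    | exact N_IUTchIII_Rmk3_11_2_ii_holds
    | exact N_IUTchIII_Rmk3_12_2_ii_holds
    | exact N_IUTchIII_Rmk3_12_2_iv_holds
    | exact N_IUTchIII_Rmk3_12_2_v_holds
    | exact N_IUTchII_Cor1_11_part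
    | exact ⟨N_IUTchII_Rmk1_11_3_ii_holds, h11⟩
    | exact N_IUTchI_Ex5_1_v_part
    | exact N_IUTchI_Rmk6_12_4_iii_holds
    | exact N_IUTchIV_Rmk2_3_2_ii_holds
    | exact N_AbsTopIII_Prop3_2_iv_part
    | exact ⟨N_IUTchI_Def3_1_holds, @Summit.ABC.IUTFork.Cor312Prov.absLogq_pos⟩

/-- **APEX, author's terms, loci transparent.** `DAGC312g.summit_of_cor312_M_statement` with the composed reading of part l: `ABC` from
V, T, A, hInd; per curve a full situation with Theorem 3.11 AS TYPED (`hThm`) and (IPL) as read (`hIPL`); `pending` granted at the ELEVEN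
unresolved loci only (`hrest`); pilot nouns, admissibility, the two finiteness clauses; the twenty inferences under the G-reading (`hC`);
the (xi-f) sentence read as Reading 1 (`hread`); the number identifications. kernel_hyps = 11 (hInd, hadm, hreal, hqreal, hThm, hIPL,
hrest, hC, hread, hΘ, hq). [claim: Mochizuki2012, status: disputed] -/
theorem summit_of_cor312_M_eleven (V : HeightFamily) (Tm : Thm110Family V) (A : AbcDictionary V)
    (hInd : MochizukiIndeterminacies Tm) {TI : V.Pt → ThetaIndex} (S : ∀ P, FullSituation (TI P))
    (Pn : ∀ P, PilotNouns (S P).toLatticeSituation) (n m : ℤ)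
    (hadm : ∀ P (j : (TI P).LabelStar) (vQ : (TI P).VQ), (Pn P).ComponentAdm n m j vQ)
    (hreal : ∀ P, (Pn P).NegLogThetaReal n m) (hqreal : ∀ P, (Pn P).NegLogQReal n m)
    (hThm : ∀ P, (S P).Statement) (hIPL : ∀ P, (S P).link.IPL) (pending : Locus → Prop)
    (hrest : ∀ c ∈ unresolvedV4, pending c) {O : Obs → Prop} (hC : ∀ P, Chain (lociReadingG (S P) pending) O)
    (hread : ∀ P (j : (TI P).LabelStar) (vQ : (TI P).VQ), O .constitutesConstruction →
      ((Pn P).toCor312Setting n m j vQ (hadm P j vQ)).RepresentedVol)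
    (hΘ : ∀ P, (Pn P).negLogTheta n m = (Tm.X P).negLogTheta) (hq : ∀ P, (Pn P).negLogQ n m = -(Tm.X P).absLogq) :
    _root_.ABC :=
  abc_of_indeterminacies_of_cor312 V Tm A hInd fun P => by
    have hc : (Pn P).Cor312At n m :=
      (Pn P).cor312At_of_componentwise n m (hadm P) (hreal P) (hqreal P)
        fun j vQ => setting_cor312_of_chain _ (lociReadingG_of_eleven (S P) pending (hThm P) (hIPL P) hrest) (hC P)
          (hread P j vQ)
    unfold Thm110Data.Cor312
    rw [← hΘ, ← hq]
    exact hc.2.2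

/-! ## DEDUP: one `Prop`, two names -/

/-- DEDUP MAP (kernel-checked): this seat's `Cor312Setting.QCongruentSubHull` (V-d `Cor312EdgeYamashita`, p411306) and the skeleton's
`Cor312Setting.QIsoInHull` (XVII `ForkRegions` §7, p410864 — typed independently within the same hour from lit's 22:47Z note) are the
SAME proposition, bridged by `Iff.rfl`. Consumers should prefer the skeleton's name (XVII owns the nouns); V-d's transport level
(`IsoFamily`, `QIsoSubHull`) and its two-sided witnesses have no twin. [folklore] -/
theorem _root_.Summit.ABC.IUTFork.Cor312Setting.qCongruentSubHull_iff_qIsoInHull (C : Cor312Setting) :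
    C.QCongruentSubHull ↔ C.QIsoInHull := Iff.rfl

/-! ## 2. The disputed inference, GLOBAL: Theorem 3.11 as typed ⟹ Cor. 3.12 as typed, for the same situation -/

/-- **APEX, THE DISPUTE AS TWO NAMED HYPOTHESES, GLOBAL FORM.** `ABC` from V, T, A, hInd; per curve a full situation `S P` (c312-1 A–D)
with pilot nouns `Pn P`; `hThm : (S P).Statement` — [IUTchIII] Theorem 3.11 AS THE AUTHOR STATES IT, typed; `hGap : Statement →
Cor312At` — THAT Theorem 3.11 yields [IUTchIII] Cor. 3.12's aggregate inequality `−|log(q)| ≤ −|log(Θ)|` (with its two finiteness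
clauses) for the pilot objects of `(n, m)` of the same situation: the inference of Step (xi) ("then follows formally", p. 184 l. 29;
denied by ScholzeStix2018 §2.2; replaced by (9-1) in LANA2026Report §9) at the level the print states it — two procession-normalized
NUMBERS; and the number identifications `hΘ`, `hq`. kernel_hyps = 5 (hInd, hThm, hGap, hΘ, hq). Nothing asserts `hGap`; c312-1's
`Thm311ToCor312` checks exhibit a model of the typed premises in which it fails. [claim: Mochizuki2012, status: disputed] -/
theorem summit_of_cor312_M_gap (V : HeightFamily) (Tm : Thm110Family V) (A : AbcDictionary V)
    (hInd : MochizukiIndeterminacies Tm) {TI : V.Pt → ThetaIndex} (S : ∀ P, FullSituation (TI P))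
    (Pn : ∀ P, PilotNouns (S P).toLatticeSituation) (n m : ℤ) (hThm : ∀ P, (S P).Statement)
    (hGap : ∀ P, (S P).Statement → (Pn P).Cor312At n m)
    (hΘ : ∀ P, (Pn P).negLogTheta n m = (Tm.X P).negLogTheta) (hq : ∀ P, (Pn P).negLogQ n m = -(Tm.X P).absLogq) :
    _root_.ABC :=
  abc_of_indeterminacies_of_cor312 V Tm A hInd fun P => by
    have hc : (Pn P).Cor312At n m := hGap P (hThm P)
    unfold Thm110Data.Cor312
    rw [← hΘ, ← hq]
    exact hc.2.2

/-! ## 3. The disputed inference COMPONENTWISE in its weakest region-level form (Yamashita's Reading 4) -/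

/-- **APEX, THE DISPUTE AS TWO NAMED HYPOTHESES, weakest licence.** `DAGC312g.summit_of_cor312_M_licence` with the licence weakened
from Reading 2 (`QSubHull`: the `q`-pilot region lies IN the hull) to Reading 4 (`QCongruentSubHull`: the hull contains an admissible
region with the `q`-pilot LOG-VOLUME — Yamashita2024IUTSurvey Cor. 13.13 proof p. 360 "contains a region which is isomorphic (not
equal) to the region determined by the q-pilot objects"): `hThm : Statement` (Theorem 3.11 as the author states it, typed) and
`hLicOfThm : Statement → componentwise QCongruentSubHull`. kernel_hyps = 8 (hInd, hadm, hreal, hqreal, hThm, hLicOfThm, hΘ, hq).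
[cite: Yamashita2024IUTSurvey, Cor. 13.13 proof p. 360 ll. 30–40] [claim: Mochizuki2012, status: disputed] -/
theorem summit_of_cor312_M_licence_congruent (V : HeightFamily) (Tm : Thm110Family V) (A : AbcDictionary V)
    (hInd : MochizukiIndeterminacies Tm) {TI : V.Pt → ThetaIndex} (S : ∀ P, FullSituation (TI P))
    (Pn : ∀ P, PilotNouns (S P).toLatticeSituation) (n m : ℤ)
    (hadm : ∀ P (j : (TI P).LabelStar) (vQ : (TI P).VQ), (Pn P).ComponentAdm n m j vQ)
    (hreal : ∀ P, (Pn P).NegLogThetaReal n m) (hqreal : ∀ P, (Pn P).NegLogQReal n m)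
    (hThm : ∀ P, (S P).Statement)
    (hLicOfThm : ∀ P, (S P).Statement → ∀ (j : (TI P).LabelStar) (vQ : (TI P).VQ),
      ((Pn P).toCor312Setting n m j vQ (hadm P j vQ)).QCongruentSubHull)
    (hΘ : ∀ P, (Pn P).negLogTheta n m = (Tm.X P).negLogTheta) (hq : ∀ P, (Pn P).negLogQ n m = -(Tm.X P).absLogq) :
    _root_.ABC :=
  abc_of_indeterminacies_of_cor312 V Tm A hInd fun P => by
    have hc : (Pn P).Cor312At n m :=
      (Pn P).cor312At_of_componentwise n m (hadm P) (hreal P) (hqreal P)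
        fun j vQ => Cor312Setting.cor312_of_qCongruentSubHull _ (hLicOfThm P (hThm P) j vQ)
    unfold Thm110Data.Cor312
    rw [← hΘ, ← hq]
    exact hc.2.2

variable {V : HeightFamily} {TI : V.Pt → ThetaIndex} (S' : ∀ P, FullSituation (TI P))
  (Pn : ∀ P, PilotNouns (S' P).toLatticeSituation) (n m : ℤ)
  (hadm : ∀ P (j : (TI P).LabelStar) (vQ : (TI P).VQ), (Pn P).ComponentAdm n m j vQ)

/-- The Reading-2 licence (`_M_licence`'s hypothesis) implies the Reading-4 licence. [folklore] -/
theorem licence_congruent_of_qSubHull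
    (h : ∀ P, (S' P).Statement → ∀ (j : (TI P).LabelStar) (vQ : (TI P).VQ),
      ((Pn P).toCor312Setting n m j vQ (hadm P j vQ)).QSubHull) :
    ∀ P, (S' P).Statement → ∀ (j : (TI P).LabelStar) (vQ : (TI P).VQ),
      ((Pn P).toCor312Setting n m j vQ (hadm P j vQ)).QCongruentSubHull :=
  fun P hP j vQ => Cor312Setting.qCongruentSubHull_of_qSubHull _ (h P hP j vQ)

/-- The Reading-1 licence (LANA's `RepresentedVol`, = (9-1)) implies the Reading-4 licence. [folklore] -/
theorem licence_congruent_of_representedVol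
    (h : ∀ P, (S' P).Statement → ∀ (j : (TI P).LabelStar) (vQ : (TI P).VQ),
      ((Pn P).toCor312Setting n m j vQ (hadm P j vQ)).RepresentedVol) :
    ∀ P, (S' P).Statement → ∀ (j : (TI P).LabelStar) (vQ : (TI P).VQ),
      ((Pn P).toCor312Setting n m j vQ (hadm P j vQ)).QCongruentSubHull :=
  fun P hP j vQ => Cor312Setting.qCongruentSubHull_of_representedVol _ (h P hP j vQ)

/-- The Reading-3 licence (`QIsImage`) implies the Reading-4 licence. [folklore] -/
theorem licence_congruent_of_qIsImage
    (h : ∀ P, (S' P).Statement → ∀ (j : (TI P).LabelStar) (vQ : (TI P).VQ),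
      ((Pn P).toCor312Setting n m j vQ (hadm P j vQ)).QIsImage) :
    ∀ P, (S' P).Statement → ∀ (j : (TI P).LabelStar) (vQ : (TI P).VQ),
      ((Pn P).toCor312Setting n m j vQ (hadm P j vQ)).QCongruentSubHull :=
  fun P hP j vQ => Cor312Setting.qCongruentSubHull_of_qIsImage _ (h P hP j vQ)

/-- **APEX, THE DISPUTE AS TWO NAMED HYPOTHESES, AGGREGATE region-level licence (V-e).** `hThm : Statement` and `hLicOfThm :
Statement → QCongruentSubHullAgg` (in the situation's hulls there is an admissible family of sub-regions whose procession-normalized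
aggregate log-volume is `−|log(q)|` — Yamashita's sentence with the print's global quantifier), plus admissibility and the two
finiteness clauses; composed through `summit_of_cor312_M_gap` by V-e `cor312At_of_qCongruentSubHullAgg`. kernel_hyps = 8 (hInd, hadm,
hreal, hqreal, hThm, hLicOfThm, hΘ, hq). [cite: Yamashita2024IUTSurvey, Cor. 13.13 proof p. 360 ll. 30–40] [claim: Mochizuki2012, status: disputed] -/
theorem summit_of_cor312_M_licence_agg (V : HeightFamily) (Tm : Thm110Family V) (A : AbcDictionary V)
    (hInd : MochizukiIndeterminacies Tm) {TI : V.Pt → ThetaIndex} (S : ∀ P, FullSituation (TI P))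
    (Pn : ∀ P, PilotNouns (S P).toLatticeSituation) (n m : ℤ)
    (hadm : ∀ P (j : (TI P).LabelStar) (vQ : (TI P).VQ), (Pn P).ComponentAdm n m j vQ)
    (hreal : ∀ P, (Pn P).NegLogThetaReal n m) (hqreal : ∀ P, (Pn P).NegLogQReal n m)
    (hThm : ∀ P, (S P).Statement) (hLicOfThm : ∀ P, (S P).Statement → (Pn P).QCongruentSubHullAgg n m)
    (hΘ : ∀ P, (Pn P).negLogTheta n m = (Tm.X P).negLogTheta) (hq : ∀ P, (Pn P).negLogQ n m = -(Tm.X P).absLogq) :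
    _root_.ABC :=
  summit_of_cor312_M_gap V Tm A hInd S Pn n m hThm
    (fun P hP => (Pn P).cor312At_of_qCongruentSubHullAgg n m (hadm P) (hreal P) (hqreal P) (hLicOfThm P hP)) hΘ hq

/-- The componentwise Reading-4 licence implies the aggregate licence (V-e `qCongruentSubHullAgg_of_componentwise`). [folklore] -/
theorem licence_agg_of_congruent (hqreal : ∀ P, (Pn P).NegLogQReal n m)
    (h : ∀ P, (S' P).Statement → ∀ (j : (TI P).LabelStar) (vQ : (TI P).VQ),
      ((Pn P).toCor312Setting n m j vQ (hadm P j vQ)).QCongruentSubHull) :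
    ∀ P, (S' P).Statement → (Pn P).QCongruentSubHullAgg n m :=
  fun P hP => (Pn P).qCongruentSubHullAgg_of_componentwise n m (hadm P) (hqreal P) (h P hP)

/-- The componentwise Reading-4 licence, with admissibility and the two finiteness clauses, implies the GLOBAL gap hypothesis of
`summit_of_cor312_M_gap` (c312-1 `PilotNouns.cor312At_of_componentwise` ∘ `cor312_of_qCongruentSubHull`): the global form is the
weakest of the ladder. [folklore] -/
theorem gap_of_licence_congruent (hreal : ∀ P, (Pn P).NegLogThetaReal n m) (hqreal : ∀ P, (Pn P).NegLogQReal n m)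
    (h : ∀ P, (S' P).Statement → ∀ (j : (TI P).LabelStar) (vQ : (TI P).VQ),
      ((Pn P).toCor312Setting n m j vQ (hadm P j vQ)).QCongruentSubHull) :
    ∀ P, (S' P).Statement → (Pn P).Cor312At n m :=
  fun P hP => (Pn P).cor312At_of_componentwise n m (hadm P) (hreal P) (hqreal P)
    fun j vQ => Cor312Setting.cor312_of_qCongruentSubHull _ (h P hP j vQ)

end Summit.ABC.IUTFork.DAG

end
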